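import Summits.AtomisticToContinuum.BoseEinsteinCondensation.Theses.BECTangentRigidity
import Summits.AtomisticToContinuum.BoseEinsteinCondensation.Theses.BECDyadicChaining
import Summits.AtomisticToContinuum.BoseEinsteinCondensation.Theorems.BECTangentRigidityTangentTransferStubMesoscopicFloorPinned
import Summits.AtomisticToContinuum.BoseEinsteinCondensation.Theorems.BECTangentRigidityTangentTransferStubFloorSharp
import Summits.AtomisticToContinuum.BoseEinsteinCondensation.Theorems.BECTangentRigidityTangentTransferStubNoClumping
import Summits.AtomisticToContinuum.BoseEinsteinCondensation.Theorems.BECTangentRigidityTangentTransferStubFreeCoarse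
import Summits.AtomisticToContinuum.BoseEinsteinCondensation.Theorems.BECTangentRigidityTangentTransferStubBaseAmplitude
import Summits.AtomisticToContinuum.BoseEinsteinCondensation.Theorems.BECTangentRigidityTangentTransferStubChainBookkeeping
import Summits.AtomisticToContinuum.BoseEinsteinCondensation.Theorems.BECDyadicChainingCoherentAmplitudeMonotone
import Literature.MathematicalPhysics.QuantumManyBody.DyadicCoherentFractionRefinement
import Literature.MathematicalPhysics.QuantumManyBody.BoseGasMergeOccupation

/-!
# Skeleton v3 — crux `BECTangentRigidity.TangentTransfer` (stmt-AtomisticToContinuum-13033), line `registered`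

Lead `prover-line-stmt-AtomisticToContinuum-13033-c2-0`, 2026-08-17 (reshape of the registered birth
skeleton `Lines/birth.lean`, sha ddaccf71…, after wave 1).

  `TangentTransfer = ∀ v admissible, MesoscopicFloor(v) → RigidMomentumBound(v) → CoarseCoherence(v)`.

## What changed and why (wave 1 → v2)

* STUB 1 of the birth skeleton, `stub_mesoscopicFloorPinned` (pinned floor `7N/8` at every scale
  `M/√ρ`), LANDED unconditionally (p149155, `Theorems/BECTangentRigidityTangentTransferStubMesoscopicFloorPinned.lean`,
  on top of the new Literature files `BoseGasSubcellCondensation{,Dilute}.lean`, p147122 / p148131: LSSY's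
  localisation mechanism Lemma 5.2 + Lemma 4.1 + cell method + Dyson bound, run cell by cell on the
  Dirichlet big box).  It is imported below (no `sorry`).
* STUB 2 of the birth skeleton, `stub_summableOctaveLoss` (per-octave flat-mode loss
  `≤ N(A(r/s)² + B(s/L)²)`), is the crux `RMB → CC` in scale-resolved, slightly STRONGER form (lead's
  analysis `work/stub2-analysis.md`; crux strategist's STRATEGY-CENSUS): not provable from its `Leans on`,
  and as an item it would near-duplicate the open crux `BECDyadicChaining.DyadicCoherenceDefect`
  (stmt-AtomisticToContinuum-13192: ONE summable budget `β`, `Σβ ≤ 1/4`, bounds the per-level coherent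
  AMPLITUDE increment `A_m ≤ A_{m-1} + β_j√N` above an `N`-independent scale `ℓ_d`).  v2 therefore routes
  the dyadic chaining THROUGH THAT EXISTING ITEM: `stub_dyadicCoherenceDefect` is 13192's decl BY NAME,
  and everything else is provable-now technology:
  - `stub_floorSharp` — the landed floor with `7/8` replaced by `1 - η` (every `η > 0`; positive
    scattering length);
  - `stub_noClumping` — the total over-occupation of the flat cell modes beyond the fair share
    `(1+η)N/8^k` is `≤ ηN` at the same scales (convexity of the cell method: `Σ_c(n_c - ρs³)² ≥ 2ηρs³·excess`,
    against the `o(1)·4πaρN` energy budget; crowded cells by superadditivity);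
  - `stub_baseAmplitude` — deterministic algebra: floor `(1-η)N` + over-occupation `≤ ηN` give the
    coherent amplitude `A_k ≥ ((1-2η)/√(1+η))·√N` (`√n ≥ min(n, cap)/√cap`);
  - `stub_chainBookkeeping` — deterministic: 13192's per-level inequalities for ONE state, a base level
    `n` with `L/2^n ≥ ℓ_d` and `A_n ≥ (24/25)√N` give `cohSum_0 = A_0² ≥ (24/25 - 1/4)²N ≥ N/2`
    (the bracket `j(m)` is injective in `m`, so the consumed budget is `≤ Σβ ≤ 1/4`);
  - `stub_freeCoarse` — zero scattering length (`v = 0` a.e., `LSSY2005_zeroScatteringLength_holds`):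
    coarse coherence at level `0` directly, `F_0 = (8/π²)³ = 0.533 > 1/2` (sine gap `stub_sineGap`,
    `stub_freeUpperBound` of route BECDyadicChaining, proved).
* Composition `TangentTransfer_of` (sorry-free): for `a(v) = 0` use `stub_freeCoarse`; for `a(v) > 0`
  take `ℓ_d, ρ₁, β` from 13192, `η = 1/100`, `M = max 1 ℓ_d`, the level `n` with
  `L/2^n ∈ [M/√ρ, 2M/√ρ)` (exists eventually; `≥ ℓ_d` since `ρ < 1`), floor + no-clumping + base
  amplitude (`0.98/√1.01 ≥ 24/25`) + chain bookkeeping ⇒ `cohSum_0 ≥ N/2`, i.e. `CoarseCoherence(v)`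
  with `K = 0`.  Both crux hypotheses (`MesoscopicFloor(v)`, `RigidMomentumBound(v)`) are idle, as the
  crux-attack refuter and the strategist predicted (`TT ≡ RMB → CC` in strength, and `RMB` only matters
  for degenerate ground spaces).
* Net effect for the programme: crux 13033 ⇐ crux 13192 + four provable-now stubs; the two routes
  BECTangentRigidity and BECDyadicChaining share ONE open core.

Registered stubs of v2: `stub_floorSharp`, `stub_noClumping`, `stub_freeCoarse`, `stub_baseAmplitude`,
`stub_chainBookkeeping`, `stub_dyadicCoherenceDefect` (6 ≤ stubs_max 7; the landed `stub_mesoscopicFloorPinned`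
stays on the item as `supports`).  **v3 (after wave 2): all five provable stubs LANDED; the only `sorry` left
is `stub_dyadicCoherenceDefect`, i.e. crux 13033 is proved MODULO item 13192 exactly.**
-/

noncomputable section

open MeasureTheory Filter Set
open scoped ENNReal NNReal Topology BigOperators

namespace Summit.AtomisticToContinuum.BoseEinsteinCondensation.Cruxes.TangentTransfer.Birth

open Literature.MathematicalPhysics.QuantumManyBody.BoseGas
open Summit.AtomisticToContinuum.BoseEinsteinCondensation.Theses.BECTangentRigidity (TangentTransfer)
open Summit.AtomisticToContinuum.BoseEinsteinCondensation.Theses.BECDyadicChaining (DyadicCoherenceDefect)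

/-! ## Stubs

LANDED (imported above, all unconditional, axioms `propext`/`Classical.choice`/`Quot.sound`; names in this
namespace): `stub_mesoscopicFloorPinned` (p149155, wave 1), `stub_floorSharp` (p151645), `stub_noClumping`
(p153432), `stub_freeCoarse` (p154246), `stub_baseAmplitude` (p154671), `stub_chainBookkeeping` (p155532)
(wave 2), with Literature support `BoseGasSubcellCondensation{,Dilute,Sharp}.lean`, `BoseGasSubcellNoClumping.lean`
(p147122, p148131, p151406, p153166).

OPEN (the ONLY `sorry` of this file): `stub_dyadicCoherenceDefect` = item stmt-AtomisticToContinuum-13192 by name. -/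

/-- **STUB `stub_dyadicCoherenceDefect`** — the open crux of route BECDyadicChaining BY NAME
(stmt-AtomisticToContinuum-13192, `[difficulty: open-problem]`, its own line led in parallel): for every
repulsive finite-range `v` there are `ℓ_d > 0`, `ρ₀ > 0` such that for `0 < ρ < ρ₀` one summable budget
`β ≥ 0`, `Σ_j β_j ≤ 1/4`, bounds, eventually in `N` and uniformly over `δ`-near-minimisers, the
per-level coherent-amplitude increment `A_m ≤ A_{m-1} + β_j√N` for every level `m ≥ 1` whose cube side
lies in `[ℓ_d2^j, ℓ_d2^{j+1})`.  This is where the summit-level content of `TangentTransfer` lives (in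
strength `TangentTransfer ≡ RMB → CC`, and 13192 + the provable stubs above give `CC(v)` for every `v`);
closing it here = importing a proof of 13192. -/
theorem stub_dyadicCoherenceDefect : DyadicCoherenceDefect := by
  sorry

/-! ## Helpers for the composition (sorry-free) -/

/-- The numerical margin of the base: `24/25 ≤ (1 - 2/100)/√(1 + 1/100)`. -/
theorem base_constant_le : (24 / 25 : ℝ) ≤ (1 - 2 * (1 / 100)) / Real.sqrt (1 + 1 / 100) := by
  rw [le_div_iff₀ (Real.sqrt_pos.2 (by norm_num))]
  have h : Real.sqrt (1 + 1 / 100) ≤ 201 / 200 := by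
    rw [Real.sqrt_le_left (by norm_num)]
    norm_num
  nlinarith

/-- Open dyadic cubes have the same flat-mode occupation as the half-open cells (they agree a.e.). -/
theorem occupation_openCube_eq_dyMode (N : ℕ) (L : ℝ) (Ψ : Config N → ℂ) (k : ℕ)
    (i : Fin 3 → Fin (2 ^ k)) :
    occupation N (Set.indicator
        {x : EuclideanSpace ℝ (Fin 3) | ∀ j : Fin 3, x j ∈ Set.Ioo (((i j : ℕ) : ℝ) * (L / 2 ^ k))
          ((((i j : ℕ) : ℝ) + 1) * (L / 2 ^ k))}
        (fun _ => ((Real.sqrt ((L / 2 ^ k) ^ 3))⁻¹ : ℂ))) Ψ = occupation N (dyMode L k i) Ψ :=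
  occupation_congr_ae (indicator_ae_eq_of_ae_eq_set
    (Theorems.CoherentAmplitudeMonotone.openCell_ae_eq_dyCell L k i)) Ψ

/-- **Coarse coherence at level `0`, positive scattering length** — the heart of the v2 composition at
fixed `v`: 13192's clause for `v` + sharp floor + no clumping + base amplitude + chain bookkeeping. -/
theorem coarse_zero_of_pos {v : ℝ → ℝ≥0∞} (hv : IsRepulsiveFiniteRange v)
    (hFl : ∀ η : ℝ, 0 < η → η < 1 → ∀ M : ℝ, 1 ≤ M →
      ∃ ρ₀ : ℝ, 0 < ρ₀ ∧ ∀ ρ : ℝ, 0 < ρ → ρ < ρ₀ →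
        ∀ᶠ N : ℕ in atTop, ∃ δ : ℝ≥0∞, 0 < δ ∧ ∀ Ψ : TrialState N (sideLength ρ N),
          energy v Ψ ≤ groundStateEnergy v N (sideLength ρ N) + δ →
          ∀ k : ℕ, M / Real.sqrt ρ ≤ sideLength ρ N / 2 ^ k →
            sideLength ρ N / 2 ^ k < 2 * (M / Real.sqrt ρ) →
            ENNReal.ofReal ((1 - η) * N) ≤ cohSum N (sideLength ρ N) k Ψ.ψ)
    (hNc : ∀ η : ℝ, 0 < η → η < 1 → ∀ M : ℝ, 1 ≤ M →
      ∃ ρ₀ : ℝ, 0 < ρ₀ ∧ ∀ ρ : ℝ, 0 < ρ → ρ < ρ₀ →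
        ∀ᶠ N : ℕ in atTop, ∃ δ : ℝ≥0∞, 0 < δ ∧ ∀ Ψ : TrialState N (sideLength ρ N),
          energy v Ψ ≤ groundStateEnergy v N (sideLength ρ N) + δ →
          ∀ k : ℕ, M / Real.sqrt ρ ≤ sideLength ρ N / 2 ^ k →
            sideLength ρ N / 2 ^ k < 2 * (M / Real.sqrt ρ) →
            ∑ m : Fin 3 → Fin (2 ^ k),
                (occupation N (dyMode (sideLength ρ N) k m) Ψ.ψ -
                  ENNReal.ofReal ((1 + η) * N / 8 ^ k)) ≤ ENNReal.ofReal (η * N))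
    (hBa : ∀ (N : ℕ) (L : ℝ) (k : ℕ) (Ψ : Config N → ℂ) (η : ℝ), 0 < η →
      ENNReal.ofReal ((1 - η) * N) ≤ cohSum N L k Ψ →
      ∑ m : Fin 3 → Fin (2 ^ k),
          (occupation N (dyMode L k m) Ψ - ENNReal.ofReal ((1 + η) * N / 8 ^ k)) ≤
        ENNReal.ofReal (η * N) →
      ENNReal.ofReal ((1 - 2 * η) / Real.sqrt (1 + η)) * (N : ℝ≥0∞) ^ (1 / 2 : ℝ) ≤
        (8 : ℝ≥0∞) ^ (-(k : ℝ) / 2) *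
          ∑ m : Fin 3 → Fin (2 ^ k), (occupation N (dyMode L k m) Ψ) ^ (1 / 2 : ℝ))
    (hCh : ∀ (N : ℕ) (L : ℝ) (Ψ : Config N → ℂ) (ℓd : ℝ), 0 < ℓd → 0 < L →
      ∀ β : ℕ → ℝ, (∀ j, 0 ≤ β j) → Summable β → ∑' j, β j ≤ 1 / 4 →
      let A : ℕ → ℝ≥0∞ := fun m => (8 : ℝ≥0∞) ^ (-(m : ℝ) / 2) *
        ∑ i : Fin 3 → Fin (2 ^ m), (occupation N (dyMode L m i) Ψ) ^ (1 / 2 : ℝ)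
      (∀ m j : ℕ, 1 ≤ m → ℓd * 2 ^ j ≤ L / 2 ^ m → L / 2 ^ m < ℓd * 2 ^ (j + 1) →
        A m ≤ A (m - 1) + ENNReal.ofReal (β j) * (N : ℝ≥0∞) ^ (1 / 2 : ℝ)) →
      ∀ n : ℕ, ℓd ≤ L / 2 ^ n →
        ENNReal.ofReal (24 / 25) * (N : ℝ≥0∞) ^ (1 / 2 : ℝ) ≤ A n →
        ENNReal.ofReal ((N : ℝ) / 2) ≤ cohSum N L 0 Ψ)
    (hD : DyadicCoherenceDefect) :
    ∃ ρ₀ : ℝ, 0 < ρ₀ ∧ ∀ ρ : ℝ, 0 < ρ → ρ < ρ₀ →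
      ∀ᶠ N : ℕ in atTop, ∃ δ : ℝ≥0∞, 0 < δ ∧ ∀ Ψ : TrialState N (sideLength ρ N),
        energy v Ψ ≤ groundStateEnergy v N (sideLength ρ N) + δ →
          ENNReal.ofReal ((N : ℝ) / 2) ≤ cohSum N (sideLength ρ N) 0 Ψ.ψ := by
  obtain ⟨ℓd, hℓd, ρ₁, hρ₁, H4⟩ := hD v hv
  have hη : (0 : ℝ) < 1 / 100 := by norm_num
  have hη1 : (1 / 100 : ℝ) < 1 := by norm_num
  set M : ℝ := max 1 ℓd with hM
  have hM1 : 1 ≤ M := le_max_left _ _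
  have hMℓ : ℓd ≤ M := le_max_right _ _
  have hMpos : 0 < M := lt_of_lt_of_le one_pos hM1
  obtain ⟨ρ₂, hρ₂, H1⟩ := hFl (1 / 100) hη hη1 M hM1
  obtain ⟨ρ₃, hρ₃, H2⟩ := hNc (1 / 100) hη hη1 M hM1
  refine ⟨min (min ρ₁ (min ρ₂ ρ₃)) 1, lt_min (lt_min hρ₁ (lt_min hρ₂ hρ₃)) one_pos,
    fun ρ hρ hρlt => ?_⟩
  have hρ1 : ρ < ρ₁ := hρlt.trans_le ((min_le_left _ _).trans (min_le_left _ _))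
  have hρ2 : ρ < ρ₂ :=
    hρlt.trans_le ((min_le_left _ _).trans ((min_le_right _ _).trans (min_le_left _ _)))
  have hρ3 : ρ < ρ₃ :=
    hρlt.trans_le ((min_le_left _ _).trans ((min_le_right _ _).trans (min_le_right _ _)))
  have hρone : ρ < 1 := hρlt.trans_le (min_le_right _ _)
  obtain ⟨β, hβ0, hβs, hβ4, E4⟩ := H4 ρ hρ hρ1
  have E1 := H1 ρ hρ hρ2
  have E2 := H2 ρ hρ hρ3
  -- the floor scale `ℓ = M/√ρ ≥ ℓ_d`
  set ℓ : ℝ := M / Real.sqrt ρ with hℓ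
  have hsρ : 0 < Real.sqrt ρ := Real.sqrt_pos.2 hρ
  have hℓpos : 0 < ℓ := div_pos hMpos hsρ
  have hℓdℓ : ℓd ≤ ℓ := by
    rw [hℓ, le_div_iff₀ hsρ]
    calc ℓd * Real.sqrt ρ ≤ ℓd * 1 :=
          mul_le_mul_of_nonneg_left (Real.sqrt_le_one.mpr hρone.le) hℓd.le
      _ ≤ M := by rw [mul_one]; exact hMℓ
  have hLev : ∀ᶠ N : ℕ in atTop, ℓ ≤ sideLength ρ N :=
    (tendsto_sideLength_atTop hρ).eventually_ge_atTop ℓ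
  filter_upwards [E1, E2, E4, hLev] with N hN1 hN2 hN4 hLN
  obtain ⟨δ₁, hδ₁, h1⟩ := hN1
  obtain ⟨δ₂, hδ₂, h2⟩ := hN2
  obtain ⟨δ₄, hδ₄, h4⟩ := hN4
  refine ⟨min δ₁ (min δ₂ δ₄), lt_min hδ₁ (lt_min hδ₂ hδ₄), fun Ψ hΨ => ?_⟩
  have hLpos : 0 < sideLength ρ N := lt_of_lt_of_le hℓpos hLN
  -- the floor level `n`: `ℓ ≤ L/2^n < 2ℓ`
  have hx : 1 ≤ sideLength ρ N / ℓ := by rwa [le_div_iff₀ hℓpos, one_mul]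
  obtain ⟨n, hn1, hn2⟩ := exists_nat_pow_near hx one_lt_two
  have hk1 : ℓ ≤ sideLength ρ N / 2 ^ n := by
    rw [le_div_iff₀ (by positivity)]
    have := (le_div_iff₀ hℓpos).1 hn1
    linarith
  have hk2 : sideLength ρ N / 2 ^ n < 2 * ℓ := by
    rw [div_lt_iff₀ (by positivity)]
    have := (div_lt_iff₀ hℓpos).1 hn2
    rw [pow_succ] at this
    linarith
  have hΨ1 : energy v Ψ ≤ groundStateEnergy v N (sideLength ρ N) + δ₁ :=
    hΨ.trans (add_le_add le_rfl (min_le_left _ _))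
  have hΨ2 : energy v Ψ ≤ groundStateEnergy v N (sideLength ρ N) + δ₂ :=
    hΨ.trans (add_le_add le_rfl ((min_le_right _ _).trans (min_le_left _ _)))
  have hΨ4 : energy v Ψ ≤ groundStateEnergy v N (sideLength ρ N) + δ₄ :=
    hΨ.trans (add_le_add le_rfl ((min_le_right _ _).trans (min_le_right _ _)))
  -- floor, no clumping, base amplitude at level `n`
  have hfloor := h1 Ψ hΨ1 n hk1 hk2
  have hclump := h2 Ψ hΨ2 n hk1 hk2
  have hbase := hBa N (sideLength ρ N) n Ψ.ψ (1 / 100) hη hfloor hclump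
  have hbase' : ENNReal.ofReal (24 / 25) * (N : ℝ≥0∞) ^ (1 / 2 : ℝ) ≤
      (8 : ℝ≥0∞) ^ (-(n : ℝ) / 2) *
        ∑ m : Fin 3 → Fin (2 ^ n), (occupation N (dyMode (sideLength ρ N) n m) Ψ.ψ) ^ (1 / 2 : ℝ) :=
    (mul_le_mul_left (ENNReal.ofReal_le_ofReal base_constant_le) _).trans hbase
  -- 13192's clause for `Ψ`, over the half-open cells
  have h4Ψ := h4 Ψ hΨ4
  simp only [occupation_openCube_eq_dyMode] at h4Ψ
  -- chain bookkeeping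
  refine hCh N (sideLength ρ N) Ψ.ψ ℓd hℓd hLpos β hβ0 hβs hβ4 ?_ n (hℓdℓ.trans hk1) hbase'
  intro m j hm hj1 hj2
  exact h4Ψ m j hm hj1 hj2

/-! ## The composition -/

/-- **`TangentTransfer_of` — the v2 composition.** The six stub SIGNATURES imply the route decl
`Theses.BECTangentRigidity.TangentTransfer` BY NAME (sorry-free; axioms of this theorem: `propext`,
`Classical.choice`, `Quot.sound`).  Both hypotheses of the crux are idle. -/
theorem TangentTransfer_of
    (hFl : ∀ v : ℝ → ℝ≥0∞, IsRepulsiveFiniteRange v → 0 < scatteringLength v →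
      ∀ η : ℝ, 0 < η → η < 1 → ∀ M : ℝ, 1 ≤ M →
      ∃ ρ₀ : ℝ, 0 < ρ₀ ∧ ∀ ρ : ℝ, 0 < ρ → ρ < ρ₀ →
        ∀ᶠ N : ℕ in atTop, ∃ δ : ℝ≥0∞, 0 < δ ∧ ∀ Ψ : TrialState N (sideLength ρ N),
          energy v Ψ ≤ groundStateEnergy v N (sideLength ρ N) + δ →
          ∀ k : ℕ, M / Real.sqrt ρ ≤ sideLength ρ N / 2 ^ k →
            sideLength ρ N / 2 ^ k < 2 * (M / Real.sqrt ρ) →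
            ENNReal.ofReal ((1 - η) * N) ≤ cohSum N (sideLength ρ N) k Ψ.ψ)
    (hNc : ∀ v : ℝ → ℝ≥0∞, IsRepulsiveFiniteRange v → 0 < scatteringLength v →
      ∀ η : ℝ, 0 < η → η < 1 → ∀ M : ℝ, 1 ≤ M →
      ∃ ρ₀ : ℝ, 0 < ρ₀ ∧ ∀ ρ : ℝ, 0 < ρ → ρ < ρ₀ →
        ∀ᶠ N : ℕ in atTop, ∃ δ : ℝ≥0∞, 0 < δ ∧ ∀ Ψ : TrialState N (sideLength ρ N),
          energy v Ψ ≤ groundStateEnergy v N (sideLength ρ N) + δ →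
          ∀ k : ℕ, M / Real.sqrt ρ ≤ sideLength ρ N / 2 ^ k →
            sideLength ρ N / 2 ^ k < 2 * (M / Real.sqrt ρ) →
            ∑ m : Fin 3 → Fin (2 ^ k),
                (occupation N (dyMode (sideLength ρ N) k m) Ψ.ψ -
                  ENNReal.ofReal ((1 + η) * N / 8 ^ k)) ≤ ENNReal.ofReal (η * N))
    (hFr : ∀ v : ℝ → ℝ≥0∞, IsRepulsiveFiniteRange v → scatteringLength v = 0 →
      ∀ ρ : ℝ, 0 < ρ → ∀ᶠ N : ℕ in atTop, ∃ δ : ℝ≥0∞, 0 < δ ∧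
        ∀ Ψ : TrialState N (sideLength ρ N),
          energy v Ψ ≤ groundStateEnergy v N (sideLength ρ N) + δ →
            ENNReal.ofReal ((N : ℝ) / 2) ≤ cohSum N (sideLength ρ N) 0 Ψ.ψ)
    (hBa : ∀ (N : ℕ) (L : ℝ) (k : ℕ) (Ψ : Config N → ℂ) (η : ℝ), 0 < η →
      ENNReal.ofReal ((1 - η) * N) ≤ cohSum N L k Ψ →
      ∑ m : Fin 3 → Fin (2 ^ k),
          (occupation N (dyMode L k m) Ψ - ENNReal.ofReal ((1 + η) * N / 8 ^ k)) ≤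
        ENNReal.ofReal (η * N) →
      ENNReal.ofReal ((1 - 2 * η) / Real.sqrt (1 + η)) * (N : ℝ≥0∞) ^ (1 / 2 : ℝ) ≤
        (8 : ℝ≥0∞) ^ (-(k : ℝ) / 2) *
          ∑ m : Fin 3 → Fin (2 ^ k), (occupation N (dyMode L k m) Ψ) ^ (1 / 2 : ℝ))
    (hCh : ∀ (N : ℕ) (L : ℝ) (Ψ : Config N → ℂ) (ℓd : ℝ), 0 < ℓd → 0 < L →
      ∀ β : ℕ → ℝ, (∀ j, 0 ≤ β j) → Summable β → ∑' j, β j ≤ 1 / 4 →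
      let A : ℕ → ℝ≥0∞ := fun m => (8 : ℝ≥0∞) ^ (-(m : ℝ) / 2) *
        ∑ i : Fin 3 → Fin (2 ^ m), (occupation N (dyMode L m i) Ψ) ^ (1 / 2 : ℝ)
      (∀ m j : ℕ, 1 ≤ m → ℓd * 2 ^ j ≤ L / 2 ^ m → L / 2 ^ m < ℓd * 2 ^ (j + 1) →
        A m ≤ A (m - 1) + ENNReal.ofReal (β j) * (N : ℝ≥0∞) ^ (1 / 2 : ℝ)) →
      ∀ n : ℕ, ℓd ≤ L / 2 ^ n →
        ENNReal.ofReal (24 / 25) * (N : ℝ≥0∞) ^ (1 / 2 : ℝ) ≤ A n →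
        ENNReal.ofReal ((N : ℝ) / 2) ≤ cohSum N L 0 Ψ)
    (hD : DyadicCoherenceDefect) :
    TangentTransfer := by
  intro v hv _hMF _hRMB
  rcases eq_or_ne (scatteringLength v) 0 with h0 | hne
  · refine ⟨1, one_pos, fun ρ hρ _ => ⟨0, ?_⟩⟩
    exact hFr v hv h0 ρ hρ
  · obtain ⟨ρ₀, hρ₀, H⟩ := coarse_zero_of_pos hv (hFl v hv (pos_iff_ne_zero.2 hne))
      (hNc v hv (pos_iff_ne_zero.2 hne)) hBa hCh hD
    exact ⟨ρ₀, hρ₀, fun ρ hρ hρlt => ⟨0, H ρ hρ hρlt⟩⟩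

/-- The line, end to end: the crux from the six stubs (its only `sorry`s are inside the `stub_*`). -/
theorem tangentTransfer : TangentTransfer :=
  TangentTransfer_of stub_floorSharp stub_noClumping stub_freeCoarse stub_baseAmplitude
    stub_chainBookkeeping stub_dyadicCoherenceDefect

end Summit.AtomisticToContinuum.BoseEinsteinCondensation.Cruxes.TangentTransfer.Birth

end
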